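import Mathlib
import Summits.NavierStokesRegularity.FluidComputer.AbcClassIEigenpairOfComplexBases
import Summits.NavierStokesRegularity.FluidComputer.AbcClassIIEigenpairUniqueClassII

/-!
# GROUP-B, **CLASS I** — (D7) COMPLETENESS: ISOLATION IN `amc`-COORDINATES ⇒ NO OTHER CLASSICAL CLASS-I EIGENPAIR IN THE
# BALL; the 3-B-nested row as «∃! class-I eigenvalue» (profile-cert-3 g9, cell `ns-blowup`, 2026-08-27; the class-I twin
# of cert-3 g8's `AbcClassIIComplexBasesCompleteness` + `AbcClassIIEigenpairUniqueClassII`)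
HONEST FRAMING (D-0035/D-0074): not a claim about Navier–Stokes blow-up. WHAT THIS IS NOT: not NS evidence;
MODEL lane (NS linearised about `abcFlow 1 1 1`, CLASS I); no certificate, number or census word moves.
* `coords_of_classI_certifier_eigen`: a classical eigenpair `(z, u)` of the tree's linearised operator whose Fourier
  family is CLASS I (via cert-3 g8's character-free `AbcLatticeEigenAnalysis` — the converse of instab4's synthesis)
  has a non-zero amc-coordinate eigenvector with all moments finite, for ANY complex orthonormal class-I family;
* **`eq_of_classI_eigenfunction_of_isolated`**: ISOLATION in amc-coordinates within `r` of `λ⋆` ⇒ every classical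
  eigenpair with class-I coefficients and `‖z − λ⋆‖ < r` has `z = λ⋆`;
* **`unique_classI_eigenvalue_of_nested_certificate`**: the class-I 3-B-nested row packaged as «there is `λ⋆` near `λ̃`,
  `Torus.IsLinNSEigenvalue`, and it is the ONLY class-I eigenvalue in the isolation ball».
Mathlib + the files named; no new definitions. bears_on LADDER-NS N5 / Z4-a(1) ((D7) for the T2/T4 rows). [folklore].
-/

noncomputable section

open scoped BigOperators ComplexConjugate InnerProductSpace
open Finset MeasureTheory UnitAddTorus

namespace Summit.NavierStokesRegularity.FluidComputer.AbcClassIEigenpair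

open Literature.Analysis.FunctionSpaces Literature.Analysis.FunctionSpaces.Torus
open Literature.Analysis.FunctionSpaces.EuclideanSpace
open Literature.Analysis.FluidPDE Literature.Analysis.FluidPDE.SteadyLattice
open Literature.Analysis.FluidPDE.ScalarFourier
open Summit.NavierStokesRegularity.FluidComputer.AbcClassI
open Summit.NavierStokesRegularity.FluidComputer.AbcClassII (Fam crossForm secOp rotR rotS sgnOrbit cube extend
  restrictTo Orbit toOrbit onormSq osupNorm cubeOrbits nbrOrbits mem_nbrOrbits mem_nbrOrbits_comm toOrbit_eq_iff
  mem_cubeOrbits onormSq_nonneg neg_mem_of_orbitClosed inner_eq_sum_extend extend_apply_of_mem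
  extend_apply_of_not_mem sq_osupNorm_le_onormSq kdot_cut sum_cube_filter_eq mem_sgnOrbit_self)
open Summit.NavierStokesRegularity.FluidComputer.AbcClassIIEigenpair (summable_sq_weights_of_rapidDecay)

section Coords

variable (wf : Idx → Fam)
variable (hws : ∀ i : Idx, ∀ k ∉ i.1.1, wf i k = 0)
variable (hwt : ∀ (i : Idx) (k : Fin 3 → ℤ), ∑ j : Fin 3, ((k j : ℤ) : ℂ) * wf i k j = 0)
variable (hwI : ∀ i : Idx, IsClassI (wf i))
variable (hwon : ∀ (O : Orbit) (a b : Fin (odim O)),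
  ∑ k ∈ O.1, (inner ℂ (wf ⟨O, a⟩ k) (wf ⟨O, b⟩ k) : ℂ) = if a = b then 1 else 0)
variable (amc : Idx → Idx → ℂ)
variable (hamc : ∀ i j : Idx, amc i j =
  ∑ k ∈ i.1.1, (inner ℂ (wf i k) (Torus.lerayCoeff k (crossForm 1 1 1 (wf j) k)) : ℂ))

/-- **The `bfam`-coordinates of a class-I transversal family reproduce it on every orbit** (complex
completeness per orbit). -/
theorem expand_bfam_of_classI {c : Fam} (hct : ∀ k : Fin 3 → ℤ, ∑ j : Fin 3, ((k j : ℤ) : ℂ) * c k j = 0)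
    (hcI : IsClassI c) (O : Orbit) :
    ∀ k ∈ O.1, c k = ∑ a : Fin (AbcClassI.odim O), (∑ k' ∈ O.1, (inner ℂ (AbcClassI.bfam ⟨O, a⟩ k') (c k') : ℂ)) • AbcClassI.bfam ⟨O, a⟩ k := by
  classical
  intro k hk
  set cO : Fam := fun k' => if k' ∈ O.1 then c k' else 0 with hcO
  have hsupp : ∀ k' ∉ O.1, cO k' = 0 := fun k' hk' => if_neg hk'
  have hexp := expand_complex O hsupp (kdot_cut hct O.1) (hcI.cut O.orbitClosed)
  have hcoef : ∀ a : Fin (odim O), ∑ k' ∈ O.1, (inner ℂ (bfam ⟨O, a⟩ k') (cO k') : ℂ) =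
      ∑ k' ∈ O.1, (inner ℂ (bfam ⟨O, a⟩ k') (c k') : ℂ) := fun a =>
    Finset.sum_congr rfl fun k' hk' => by rw [hcO]; simp only [if_pos hk']
  have hk' : c k = cO k := by rw [hcO]; simp only [if_pos hk]
  rw [hk']
  conv_lhs => rw [hexp]
  rw [Finset.sum_apply]
  exact Finset.sum_congr rfl fun a _ => by rw [hcoef a]; rfl

include hws hwt hwI hwon hamc in
/-- **A class-I certifier eigenfamily has a non-zero `amc`-coordinate eigenvector with all moments finite.** -/
theorem coords_of_classI_certifier_eigen {R : ℝ} (lam : ℂ) {c : Fam} (hcr : RapidDecay c)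
    (hct : ∀ k : Fin 3 → ℤ, ∑ j : Fin 3, ((k j : ℤ) : ℂ) * c k j = 0) (hc0 : c 0 = 0) (hcI : IsClassI c)
    (hL : ∀ k : Fin 3 → ℤ, ((-(freqNormSq k / R) : ℝ) : ℂ) • c k + Torus.lerayCoeff k (crossForm 1 1 1 c k) =
      lam • c k)
    (hcne : c ≠ 0) :
    ∃ x : AbcClassI.Idx → ℂ, x ≠ 0 ∧
      (∀ i : AbcClassI.Idx, ((-(onormSq i.1 / R) : ℝ) : ℂ) * x i + ∑ j ∈ AbcClassI.nbrIdx i, amc i j * x j = lam * x i) ∧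
      ∀ s : ℕ, Summable fun i : AbcClassI.Idx => (1 + onormSq i.1) ^ s * ‖x i‖ ^ 2 := by
  classical
  -- coordinates in instab4's real basis
  set wa : Idx → ℂ := fun i => ∑ k' ∈ i.1.1, (inner ℂ (bfam i k') (c k') : ℂ) with hwa
  have hexp : ∀ O : Orbit, ∀ k ∈ O.1, c k = ∑ a : Fin (odim O), wa ⟨O, a⟩ • bfam ⟨O, a⟩ k :=
    fun O k hk => expand_bfam_of_classI hct hcI O k hk
  -- the `amat`-equation
  have hcoordA : ∀ i : Idx, ((-(onormSq i.1 / R) : ℝ) : ℂ) * wa i +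
      ∑ j ∈ nbrIdx i, ((amat i j : ℝ) : ℂ) * wa j = lam * wa i := by
    rintro ⟨O, a⟩
    -- the right-hand side and the diagonal part, paired with `bfam ⟨O, a⟩`
    have hrhs : lam * wa ⟨O, a⟩ = ∑ k ∈ O.1, (inner ℂ (bfam ⟨O, a⟩ k) (lam • c k) : ℂ) := by
      change lam * ∑ k' ∈ O.1, (inner ℂ (bfam ⟨O, a⟩ k') (c k') : ℂ) = _
      rw [Finset.mul_sum]
      exact Finset.sum_congr rfl fun k _ => by rw [inner_smul_right]
    have hdiag : ∑ k ∈ O.1, (inner ℂ (bfam ⟨O, a⟩ k) (((-(freqNormSq k / R) : ℝ) : ℂ) • c k) : ℂ) =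
        ((-(onormSq O / R) : ℝ) : ℂ) * wa ⟨O, a⟩ := by
      change _ = ((-(onormSq O / R) : ℝ) : ℂ) * ∑ k' ∈ O.1, (inner ℂ (bfam ⟨O, a⟩ k') (c k') : ℂ)
      rw [Finset.mul_sum]
      exact Finset.sum_congr rfl fun k hk => by rw [inner_smul_right, O.freqNormSq_eq hk]
    -- the first-order part: locality, then the basis pairings
    set S : Finset Idx := (nbrOrbits O).sigma fun O' => (Finset.univ : Finset (Fin (odim O'))) with hS
    have hloc : ∀ k ∈ O.1, crossForm 1 1 1 c k = crossForm 1 1 1 (∑ j ∈ S, wa j • bfam j) k := by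
      intro k hk
      rw [hS]
      unfold crossForm
      refine Finset.sum_congr rfl fun s hs => ?_
      rw [neighbour_value c wa hexp hc0 O hk hs]
    have hfirst : ∑ k ∈ O.1, (inner ℂ (bfam ⟨O, a⟩ k) (Torus.lerayCoeff k (crossForm 1 1 1 c k)) : ℂ) =
        ∑ j ∈ S, ((amat ⟨O, a⟩ j : ℝ) : ℂ) * wa j := by
      have e1 : ∀ k ∈ O.1, (inner ℂ (bfam ⟨O, a⟩ k) (Torus.lerayCoeff k (crossForm 1 1 1 c k)) : ℂ) =
          ∑ j ∈ S, wa j * (inner ℂ (bfam ⟨O, a⟩ k) (Torus.lerayCoeff k (crossForm 1 1 1 (bfam j) k)) : ℂ) := by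
        intro k hk
        rw [hloc k hk, lerayCrossForm_sum_smul S (fun j => j) wa k, inner_sum]
        exact Finset.sum_congr rfl fun j _ => by rw [inner_smul_right]
      rw [Finset.sum_congr rfl e1, Finset.sum_comm]
      refine Finset.sum_congr rfl fun j _ => ?_
      rw [← Finset.mul_sum, ← amat_eq ⟨O, a⟩ j, mul_comm]
    -- sum the certifiers' equation against `bfam ⟨O, a⟩`
    have hsum : ∑ k ∈ O.1, (inner ℂ (bfam ⟨O, a⟩ k)
        (((-(freqNormSq k / R) : ℝ) : ℂ) • c k + Torus.lerayCoeff k (crossForm 1 1 1 c k)) : ℂ) =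
        ∑ k ∈ O.1, (inner ℂ (bfam ⟨O, a⟩ k) (lam • c k) : ℂ) :=
      Finset.sum_congr rfl fun k _ => by rw [hL k]
    simp only [inner_add_right, Finset.sum_add_distrib] at hsum
    rw [hdiag, hfirst, ← hrhs] at hsum
    exact hsum
  -- Parseval per orbit and weighted summability
  have hpars : ∀ O : Orbit, ∑ a : Fin (odim O), ‖wa ⟨O, a⟩‖ ^ 2 = ∑ k ∈ O.1, ‖c k‖ ^ 2 := by
    intro O
    rw [← sum_norm_sq_orbitExpansion O wa]
    refine Finset.sum_congr rfl fun k hk => ?_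
    rw [hexp O k hk, Finset.sum_apply]
    rfl
  have hsumA : ∀ s : ℕ, Summable fun i : Idx => (1 + onormSq i.1) ^ s * ‖wa i‖ ^ 2 := by
    intro s
    have htot := summable_sq_weights_of_rapidDecay hcr s
    refine summable_of_sum_le (c := ∑' k, (1 + freqNormSq k) ^ s * ‖c k‖ ^ 2)
      (fun i => mul_nonneg (pow_nonneg (by linarith [onormSq_nonneg i.1]) _) (sq_nonneg _)) fun u => ?_
    obtain ⟨n, hn⟩ : ∃ n, u ⊆ cubeIdx n :=
      ⟨u.sup fun i => osupNorm i.1, fun i hi =>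
        mem_cubeIdx.mpr (Finset.le_sup (f := fun i : Idx => osupNorm i.1) hi)⟩
    have hg0 : ∀ k, 0 ≤ (1 + freqNormSq k) ^ s * ‖c k‖ ^ 2 := fun k =>
      mul_nonneg (pow_nonneg (by linarith [freqNormSq_nonneg k]) _) (sq_nonneg _)
    calc ∑ i ∈ u, (1 + onormSq i.1) ^ s * ‖wa i‖ ^ 2
        ≤ ∑ i ∈ cubeIdx n, (1 + onormSq i.1) ^ s * ‖wa i‖ ^ 2 :=
          Finset.sum_le_sum_of_subset_of_nonneg hn fun i _ _ =>
            mul_nonneg (pow_nonneg (by linarith [onormSq_nonneg i.1]) _) (sq_nonneg _)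
      _ = ∑ O ∈ cubeOrbits n, ∑ k ∈ O.1, (1 + freqNormSq k) ^ s * ‖c k‖ ^ 2 := by
          rw [sum_cubeIdx_eq n (fun i => (1 + onormSq i.1) ^ s * ‖wa i‖ ^ 2)]
          refine Finset.sum_congr rfl fun O _ => ?_
          change ∑ a : Fin (odim O), (1 + onormSq O) ^ s * ‖wa (⟨O, a⟩ : Idx)‖ ^ 2 = _
          rw [← Finset.mul_sum, hpars O, Finset.mul_sum]
          exact Finset.sum_congr rfl fun k hk => by rw [O.freqNormSq_eq hk]
      _ = ∑ k ∈ (cube n).filter (fun k => k ≠ 0), (1 + freqNormSq k) ^ s * ‖c k‖ ^ 2 :=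
          (sum_cube_filter_eq n _).symm
      _ ≤ ∑' k, (1 + freqNormSq k) ^ s * ‖c k‖ ^ 2 := htot.sum_le_tsum _ fun k _ => hg0 k
  -- non-vanishing
  have hwane : wa ≠ 0 := by
    intro h0
    apply hcne
    funext k
    by_cases hk : k = 0
    · subst hk; exact hc0
    · rw [hexp (toOrbit k hk) k (mem_sgnOrbit_self k)]
      rw [Pi.zero_apply]
      exact Finset.sum_eq_zero fun a _ => by rw [show wa ⟨toOrbit k hk, a⟩ = 0 from congrFun h0 _, zero_smul]
  -- into the complex family
  obtain ⟨x, -, hEx, hsumsx, hnex⟩ := ccoord_transfer_back wf hws hwt hwI hwon amc hamc lam wa hcoordA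
  refine ⟨x, hnex hwane, hEx, fun s => ?_⟩
  exact summable_of_cube_sums (fun i => (1 + onormSq i.1) ^ s)
    (fun i => pow_nonneg (by linarith [onormSq_nonneg i.1]) _) wa x
    (fun n => hsumsx n (fun O => (1 + onormSq O) ^ s)) (hsumA s)

include hws hwt hwI hwon hamc in
/-- **(D7) ISOLATION in coordinates ⇒ no other class-I eigenvalue.** If `λ⋆` is isolated within `r` in
`amc`-coordinates and `(z, u)` is a classical eigenpair of the linearisation about `abcFlow 1 1 1` at viscosity
`1/(2πR)` with `u ≠ 0`, class-I Fourier coefficients, and `‖z − λ⋆‖ < r`, then `z = λ⋆`. -/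
theorem eq_of_classI_eigenfunction_of_isolated {R : ℝ} (hR : 1 ≤ R) (lam z : ℂ) {r : ℝ}
    (hisol : ∀ z' : ℂ, z' ≠ lam → ‖z' - lam‖ < r →
      ∀ w : AbcClassI.Idx → ℂ, (Summable fun i : AbcClassI.Idx => (1 + onormSq i.1 / R) ^ 2 * ‖w i‖ ^ 2) →
        (∀ i : AbcClassI.Idx, ((-(onormSq i.1 / R) : ℝ) : ℂ) * w i +
          ∑ j ∈ AbcClassI.nbrIdx i, amc i j * w j = z' * w i) → w = 0)
    {u : UnitAddTorus (Fin 3) → EuclideanSpace ℂ (Fin 3)}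
    (hu : Torus.LinNSResolventRel (1 / (2 * Real.pi * R)) (Torus.abcFlow 1 1 1) (2 * Real.pi * z) u 0)
    (hu0 : u ≠ 0) (hII : IsClassI (mFourierCoeff u)) (hdist : ‖z - lam‖ < r) : z = lam := by
  have hR0 : 0 < R := by linarith
  obtain ⟨hcr, hct, hc0, hL, hne⟩ :=
    AbcLatticeEigenAnalysis.certifier_eigen_of_linNSResolventRel_abcFlow 1 1 1 hR0 z hu
  have hL' : ∀ k : Fin 3 → ℤ, ((-(freqNormSq k / R) : ℝ) : ℂ) • mFourierCoeff u k +
      Torus.lerayCoeff k (crossForm 1 1 1 (mFourierCoeff u) k) = z • mFourierCoeff u k := fun k => hL k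
  obtain ⟨x, hx0, hEx, hsum⟩ :=
    coords_of_classI_certifier_eigen wf hws hwt hwI hwon amc hamc z hcr hct hc0 hII hL' (hne hu0)
  by_contra hzl
  have hsum2 : Summable fun i : Idx => (1 + onormSq i.1 / R) ^ 2 * ‖x i‖ ^ 2 := by
    refine Summable.of_nonneg_of_le (fun i => mul_nonneg (sq_nonneg _) (sq_nonneg _)) (fun i => ?_) (hsum 2)
    have h3 : 1 + onormSq i.1 / R ≤ 1 + onormSq i.1 := by
      have h4 : onormSq i.1 / R ≤ onormSq i.1 := div_le_self (onormSq_nonneg i.1) hR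
      linarith
    have h5 : 0 ≤ 1 + onormSq i.1 / R := by linarith [div_nonneg (onormSq_nonneg i.1) hR0.le]
    exact mul_le_mul_of_nonneg_right (pow_le_pow_left₀ h5 h3 2) (sq_nonneg _)
  exact hx0 (hisol z hzl hdist x hsum2 hEx)

end Coords

section Unique

variable (wf : Idx → Fam)
variable (hws : ∀ i : Idx, ∀ k ∉ i.1.1, wf i k = 0)
variable (hwt : ∀ (i : Idx) (k : Fin 3 → ℤ), ∑ j : Fin 3, ((k j : ℤ) : ℂ) * wf i k j = 0)
variable (hwI : ∀ i : Idx, IsClassI (wf i))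
variable (hwon : ∀ (O : Orbit) (a b : Fin (odim O)),
  ∑ k ∈ O.1, (inner ℂ (wf ⟨O, a⟩ k) (wf ⟨O, b⟩ k) : ℂ) = if a = b then 1 else 0)
variable (amc : Idx → Idx → ℂ)
variable (hamc : ∀ i j : Idx, amc i j =
  ∑ k ∈ i.1.1, (inner ℂ (wf i k) (Torus.lerayCoeff k (crossForm 1 1 1 (wf j) k)) : ℂ))

include hws hwt hwI hwon hamc in
/-- **3-B-nested row ⇒ existence and uniqueness among class-I eigenvalues in the isolation ball.** -/
theorem unique_classI_eigenvalue_of_nested_certificate {R : ℝ} (hR : 1 ≤ R)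
    (K Kv : ℕ) (lt : ℂ)
    (vt : AbcClassI.Idx → ℂ) (hvt0 : ∀ i, i ∉ AbcClassI.cubeIdx Kv → vt i = 0)
    {r₀ nt : ℝ} (hr₀ : 0 ≤ r₀) (hnt : 0 ≤ nt)
    (hres : ∑ i ∈ AbcClassI.cubeIdx Kv ∪ (AbcClassI.cubeIdx Kv).biUnion AbcClassI.nbrIdx,
      ‖(if i ∈ AbcClassI.cubeIdx Kv then (lt - ((-(onormSq i.1 / R) : ℝ) : ℂ)) * vt i else 0) -
        ∑ j ∈ AbcClassI.cubeIdx Kv, amc i j * vt j‖ ^ 2 ≤ r₀ ^ 2)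
    (hntb : ∑ i ∈ AbcClassI.cubeIdx Kv \ AbcClassI.cubeIdx K, ‖vt i‖ ^ 2 ≤ nt ^ 2)
    (Binv : ((↥(AbcClassI.cubeIdx K) → ℂ) × ℂ) →ₗ[ℂ] ((↥(AbcClassI.cubeIdx K) → ℂ) × ℂ))
    (hBinv : ∀ (c : ↥(AbcClassI.cubeIdx K) → ℂ) (m : ℂ),
      Binv (fun i : ↥(AbcClassI.cubeIdx K) => (lt - ((-(onormSq i.1.1 / R) : ℝ) : ℂ)) * c i -
          ∑ j : ↥(AbcClassI.cubeIdx K), amc i j * c j + m * vt i,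
        ∑ i : ↥(AbcClassI.cubeIdx K), conj (vt i) * c i) = (c, m))
    {α βB βC gB : ℝ} (hα : 0 ≤ α) (hβB : 0 ≤ βB) (hβC : 0 ≤ βC) (hgB : 0 ≤ gB)
    (hαM : ∀ (c : ↥(AbcClassI.cubeIdx K) → ℂ) (g : ℂ),
      ∑ j : ↥(AbcClassI.cubeIdx K), ‖(Binv (c, g)).1 j‖ ^ 2 + ‖(Binv (c, g)).2‖ ^ 2 ≤
        α ^ 2 * (∑ i : ↥(AbcClassI.cubeIdx K), ‖c i‖ ^ 2 + ‖g‖ ^ 2))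
    (hβBM : ∀ e : AbcClassI.Idx → ℂ,
      ∑ j : ↥(AbcClassI.cubeIdx K), ‖(Binv (fun i : ↥(AbcClassI.cubeIdx K) => -∑ j ∈ AbcClassI.nbrIdx i \ AbcClassI.cubeIdx K,
          amc i j * e j, 0)).1 j‖ ^ 2 +
        ‖(Binv (fun i : ↥(AbcClassI.cubeIdx K) => -∑ j ∈ AbcClassI.nbrIdx i \ AbcClassI.cubeIdx K,
          amc i j * e j, 0)).2‖ ^ 2 ≤
        βB ^ 2 * ∑ j ∈ (AbcClassI.cubeIdx K).biUnion AbcClassI.nbrIdx \ AbcClassI.cubeIdx K, ‖e j‖ ^ 2)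
    (hβCM : ∀ (c : ↥(AbcClassI.cubeIdx K) → ℂ) (g : ℂ),
      ∑ i ∈ ((AbcClassI.cubeIdx K).biUnion AbcClassI.nbrIdx ∪ AbcClassI.cubeIdx Kv) \ AbcClassI.cubeIdx K,
        ‖-∑ j : ↥(AbcClassI.cubeIdx K), amc i j * (Binv (c, g)).1 j +
          (Binv (c, g)).2 * vt i‖ ^ 2 ≤ βC ^ 2 * (∑ i : ↥(AbcClassI.cubeIdx K), ‖c i‖ ^ 2 + ‖g‖ ^ 2))
    (hgBM : ∀ e : AbcClassI.Idx → ℂ,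
      ‖(Binv (fun i : ↥(AbcClassI.cubeIdx K) => ∑ j ∈ AbcClassI.nbrIdx i \ AbcClassI.cubeIdx K,
          amc i j * e j, 0)).2‖ ^ 2 ≤
        gB ^ 2 * ∑ j ∈ (AbcClassI.cubeIdx K).biUnion AbcClassI.nbrIdx \ AbcClassI.cubeIdx K, ‖e j‖ ^ 2)
    {MU2 μ M : ℝ}
    (hshellM : ∀ e : AbcClassI.Idx → ℂ, (∀ i ∈ AbcClassI.cubeIdx K, e i = 0) →
      MU2 * ∑ i ∈ AbcClassI.cubeIdx (K + 1) \ AbcClassI.cubeIdx K, ‖e i‖ ^ 2 ≤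
        ∑ i ∈ AbcClassI.cubeIdx (K + 1) \ AbcClassI.cubeIdx K, (lt.re - (-(onormSq i.1 / R)) - Real.sqrt 2) * ‖e i‖ ^ 2 -
        RCLike.re (∑ i ∈ (AbcClassI.cubeIdx K).biUnion AbcClassI.nbrIdx \ AbcClassI.cubeIdx K,
          conj (∑ j : ↥(AbcClassI.cubeIdx K), amc i j *
            (Binv (fun i : ↥(AbcClassI.cubeIdx K) => ∑ j ∈ AbcClassI.nbrIdx i \ AbcClassI.cubeIdx K,
              amc i j * e j, 0)).1 j) * e i))
    (htailK : MU2 ≤ lt.re + ((K : ℝ) + 2) ^ 2 / R - Real.sqrt 2)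
    (hμdef : μ = MU2 - gB * nt) (hμ : 0 < μ)
    (hMdef : M = √((1 + βC ^ 2) / μ ^ 2 + (α + βB * √(1 + βC ^ 2) / μ) ^ 2))
    (hκ : 2 * Real.sqrt 2 * M ^ 2 * r₀ < 1) :
    ∃ lam : ℂ, ‖lam - lt‖ ≤ 2 * M * r₀ ∧
      Torus.IsLinNSEigenvalue (1 / (2 * Real.pi * R)) (Torus.abcFlow 1 1 1) (2 * Real.pi * lam) ∧
      (∀ (z : ℂ) (u : UnitAddTorus (Fin 3) → EuclideanSpace ℂ (Fin 3)),
        Torus.LinNSResolventRel (1 / (2 * Real.pi * R)) (Torus.abcFlow 1 1 1) (2 * Real.pi * z) u 0 → u ≠ 0 →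
          IsClassI (mFourierCoeff u) → ‖z - lam‖ < (1 - 2 * Real.sqrt 2 * M ^ 2 * r₀) / M → z = lam) ∧
      (lt.im = 0 → 2 * (2 * M * r₀) < (1 - 2 * Real.sqrt 2 * M ^ 2 * r₀) / M → lam.im = 0) := by
  obtain ⟨lam, hclose, heig, hisol, hreal, -⟩ :=
    isLinNSEigenvalue_near_of_nested_certificate_of_complex_bases wf hws hwt hwI hwon amc hamc hR
      K Kv lt vt hvt0 hr₀ hnt hres hntb Binv hBinv hα hβB hβC hgB hαM hβBM hβCM hgBM hshellM htailK hμdef hμ hMdef hκ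
  exact ⟨lam, hclose, heig, fun z u hu hu0 hII hz =>
    eq_of_classI_eigenfunction_of_isolated wf hws hwt hwI hwon amc hamc hR lam z hisol hu hu0 hII hz, hreal⟩

end Unique

end Summit.NavierStokesRegularity.FluidComputer.AbcClassIEigenpair

end
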